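import Summits.QuantumFields.YangMills.Theorems.UV3PinnedStepOrganOfMassEnvelope
import HarnessLib

/-!
# R3 (cell `ym3-torus`, YM₃ on T³ — a ladder RUNG, NOT d = 4, NOT the Clay problem) — **R-19936-S: THE ORGAN ROW (S-ii) `hSii` OF `stub_pinnedStep` FROM A
# K-GROWING MASS ENVELOPE** — the displayed row hJ of ✓`UV3PinnedStepOrganOfMassEnvelope` RELAXED from a `K`-UNIFORM log-envelope `m_K(r,·) ≤ e^{A₁}` to a
# `K`-LINEAR one `m_K(r,·) ≤ e^{A₁ + A₂·K}` (§2) and to a `K`-QUADRATIC one `m_K(r,·) ≤ e^{A₁ + A₂·K²}` (§3), at NO cost to the composition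

Seat `ym-ust-19936-w5` g18 (WIDTH-5 helper on stmt-QuantumFields-19936 `HistoryTailL`; NO claim on crux ∕ stub ∕ registry).  THEOREMS ONLY (0 `def`, 0 `sorry`);
`--supports stmt-QuantumFields-19936 --as helper`; count-neutral; CONDITIONAL on the v1 (α) socket `AlphaInputsT3AC.Of F 𝔠` and on the relaxed row.

WHY.  The organ hand's ✓`AlphaInputsT3AC.Of.hSii_of_massEnvelope (hJ)` (`ym-ust-19936-w6` g7) derives the (S-ii) row of record — ✓`UV3PinnedStepKnitOfPackage.pinnedTop_of_pinnedLF`'s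
binder `∃ CZ c A, 0 < c ∧ ∀ K j, 1 ≤ j → j + 2 ≤ K → j + ⌊(K−1)∕m⌋ ≤ K → ∀ a, ∀ᵐ W, Σ_{restricted} m_K(r,W)·e^{−mainT+Zterm} ≤ e^{CZ}·(β_{K−j}^A·e^{−c·p_𝔠(g_{K−j})²})` — from
the `K`-UNIFORM top-level a.e. mass envelope hJ `∃ A₁, ∀ K r, Admissible r → r ≠ triv → ∀ᵐ W, m_K(r,W) ≤ e^{A₁}`, setting `A := 0` and NOT using the height constraint
`j + ⌊(K−1)∕m⌋ ≤ K`.  Both unused slots are genuine slack: on the constrained heights `K ≤ m·(K−j) + m` (§0 `le_mul_height_add`) and `L^{K−j} ≤ β_{K−j} = L^{K−j}∕γ`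
(`γ ≤ 1`, §0 `pow_le_scheme_β`), so `e^{A₂K} ≤ e^{A₂m}·β_{K−j}^{⌈A₂m∕log L⌉₊}` (§0 `exp_mul_le_exp_mul_beta_pow`); and `p_𝔠(g_{K−j})² = b₀²·x(g_{K−j})^{2p₀}` with
`x(g_{K−j}) ≥ 1 + (K−j)·log L∕2` (§1 `one_add_mul_le_xlog_sqrt`), `p₀ > 2`, so `A₂K² ≤ 4A₂m²(K−j)² ≤ (c∕2)·p_𝔠(g_{K−j})² + (4A₂m²)²∕(4κ)`, `κ = (c∕2)b₀²(log L∕2)⁴`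
(§1 `exp_mul_sq_mul_exp_neg_le`).  HENCE the (S-ii) row follows VERBATIM from the weaker letters
* hJ♭ (§2 ★★★ `AlphaInputsT3AC.Of.hSii_of_growingMassEnvelope`): `∃ A₁ A₂, ∀ K r, Admissible r → r ≠ triv → ∀ᵐ W, m_K(r,W) ≤ exp(A₁ + A₂·K)` — with
  `CZ := A₁ + A₂⁺m + (6∕log L)(2L^m)³ + log(1 + C_coll∕ℓ)`, `A := ⌈A₂⁺m∕log L⌉₊`, `c := 1∕128` unchanged (`A₂⁺ = max A₂ 0`);
* hJ♯ (§3 ★★★ `AlphaInputsT3AC.Of.hSii_of_quadGrowingMassEnvelope`): `∃ A₁ A₂, ∀ K r, Admissible r → r ≠ triv → ∀ᵐ W, m_K(r,W) ≤ exp(A₁ + A₂·K²)` — with `c := 1∕256`,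
  `A := 0`, `CZ := A₁ + (6∕log L)(2L^m)³ + log(1 + C_coll∕ℓ) + (4A₂⁺m²)²∕(4κ)`.
hJ ⟹ hJ♭ ⟹ hJ♯ trivially (§4, `A₂ := 0`; `K ≤ K²`), so either is a WEAKER display than hJ with the SAME in-skeleton derivation above it (everything above `hSii` — ✓p750864
`hPinA_of_pinnedLF`, the S-faces, the door `pinnedHeightTail_of`, ✓p748552 K-19′ with ✓`exists_perHeight_bound` — is blind to `A` and to `c > 0`).

WHY IT MATTERS.  hJ's `K`-uniformity is exactly the part of the row that an exact-Haar-compatibility defect of `blockAvg ℰp` threatens: by ✓`BalabanUVNodesN08TrivialHistoryIteratedTransport`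
§2 every a.e. mass letter at the trivial history forces the `k`-uniform no-stacking bound `T_{k−1}⋯T_0 1 ≤ e^{c|T₁^{(k)}|}` on the iterated push-forward of Haar, and the only
kernel route in the tree (✓`BalabanUVNodesN08HaarCompatibilityGuardKStepMasses` §1, dominated one-step transports) is FINE-lattice extensive, `log Π_j D_j ≍ s·Σ_j #PBond(j+1)`.
The crux never needed `K`-uniformity: the S-step rate `β_{K−j}^A·e^{−c·p(g_{K−j})²}` at heights `K − j ≥ ⌊(K−1)∕m⌋` absorbs every `e^{O(K)}` (into `A`) and every `e^{O(K²)}`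
(into `c`; indeed every `e^{o(p(g_{K−j})²)}`).  If the E6′ defect turns out to contribute one non-decaying `O(|T₁|)` term per RG level, hJ fails and hJ♭ holds.

HONEST SCOPE.  Arithmetic over w6 g7's per-`(K, j, a, W)` theorem ✓`UV3PinnedStepOrganOfMassEnvelope.pinnedLF_le_of_massEnvelope` (whose `A₁` is free per run); hJ♭ ∕ hJ♯ are DISPLAYS,
not proved; nothing of `hSii`'s organ, `stub_pinnedStep`, `stub_unitEnvelope`, `hP′`, `HistoryTailL` (19936), the rung, d = 4, a mass gap or Clay is proved here; no summit
statement is proved by this seat.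

References: T. Bałaban, Commun. Math. Phys. **102** (1985) 255–275 [Balaban1985UV3] ((5) p.256, (7) p.257, (41) p.266, (67)–(71) p.273, pp.273–274).
-/

set_option autoImplicit false

noncomputable section

namespace Summit.QuantumFields.YangMills.Theorems.UV3PinnedStepOrganOfGrowingMassEnvelope

open MeasureTheory
open scoped BigOperators
open Literature.MathematicalPhysics.QuantumFieldTheory.Balaban1983to89
open Literature.MathematicalPhysics.QuantumFieldTheory.Balaban1983to89.B10LargeField (xlog one_le_xlog pFun_eq)
open Literature.MathematicalPhysics.QuantumFieldTheory.Balaban1983to89.T3ContinuumYM3Torus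
open Literature.MathematicalPhysics.QuantumFieldTheory.Balaban1983to89.T3UnitLawDensityEML (ℰp)
open Literature.MathematicalPhysics.QuantumFieldTheory.Balaban1985CMP102
open Literature.MathematicalPhysics.QuantumFieldTheory.Balaban1985CMP102.Setting
open Summit.QuantumFields.Balaban3D.Carriers
open Summit.QuantumFields.Balaban3D.Proofs.Primitives
open Summit.QuantumFields.Balaban3D.Proofs.TowerAC
open Summit.QuantumFields.Balaban3D.Proofs.StandardAC
open Summit.QuantumFields.Balaban3D.Proofs.InputsAC
open Summit.QuantumFields.YangMills.Theorems.UV3PinnedStepOrganOfMassEnvelope (pinnedLF_le_of_massEnvelope)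

/-! ## §0 The constrained heights and the inverse couplings: `K ≤ m(K−j) + m`, `L^{K−j} ≤ β_{K−j}`, `e^{A₂K} ≤ e^{A₂m}·β_{K−j}^A` -/

/-- **ON THE CONSTRAINED HEIGHTS THE RUN LENGTH IS AFFINE IN THE HEIGHT**: `j + ⌊(K−1)∕m⌋ ≤ K` with `m > 0` gives `K ≤ m·(K−j) + m`. [folklore] -/
theorem le_mul_height_add {m K j : ℕ} (hm : 0 < m) (h : j + (K - 1) / m ≤ K) : K ≤ m * (K - j) + m := by
  have h1 : (K - 1) / m < K - j + 1 := Nat.lt_succ_of_le (by omega)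
  rw [Nat.div_lt_iff_lt_mul hm] at h1
  have h3 : (K - j + 1) * m = m * (K - j) + m := by ring
  omega

/-- Real form of `le_mul_height_add`. [folklore] -/
theorem cast_le_mul_height_add {m K j : ℕ} (hm : 0 < m) (h : j + (K - 1) / m ≤ K) :
    (K : ℝ) ≤ (m : ℝ) * ((K - j : ℕ) : ℝ) + m := by
  exact_mod_cast le_mul_height_add hm h

/-- **`L^i ≤ β_i`** in the coupling window `0 < γ ≤ 1` (`β_i = (γ·L^{−i})⁻¹ = L^i∕γ` definitionally, cf. lit ✓`T3UpperLiftSplit.scheme_β_eq`). [cite: Balaban1985UV3, (5) p.256] -/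
theorem pow_le_scheme_β (F : T3Family) {γ : ℝ} (hγ : 0 < γ) (hγ1 : γ ≤ 1) (i : ℕ) :
    (F.L : ℝ) ^ i ≤ (F.scheme ℰp γ).β i := by
  have hL0 : (0 : ℝ) < F.L := by exact_mod_cast lt_trans zero_lt_one F.hL.2
  show (F.L : ℝ) ^ i ≤ (γ * ((F.L : ℝ)⁻¹) ^ i)⁻¹
  rw [mul_inv, ← inv_pow, inv_inv]
  have h1 : (1 : ℝ) ≤ γ⁻¹ := (one_le_inv₀ hγ).mpr hγ1
  calc (F.L : ℝ) ^ i = 1 * (F.L : ℝ) ^ i := (one_mul _).symm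
    _ ≤ γ⁻¹ * (F.L : ℝ) ^ i := mul_le_mul_of_nonneg_right h1 (pow_nonneg hL0.le i)

/-- **THE `β`-SLOT ABSORBS A `K`-LINEAR LOG-ENVELOPE**: for `A₂ ≥ 0`, `m > 0`, `0 < γ ≤ 1` and a constrained height `j + ⌊(K−1)∕m⌋ ≤ K`,
`e^{A₂·K} ≤ e^{A₂·m}·β_{K−j}^{⌈A₂m∕log L⌉₊}` (`K ≤ m(K−j) + m`, `e^{A₂m(K−j)} ≤ L^{⌈A₂m∕log L⌉₊(K−j)} ≤ β_{K−j}^{⌈…⌉₊}`). [cite: Balaban1985UV3, (5) p.256] -/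
theorem exp_mul_le_exp_mul_beta_pow (F : T3Family) {γ : ℝ} (hγ : 0 < γ) (hγ1 : γ ≤ 1)
    {m : ℕ} (hm : 0 < m) {A₂ : ℝ} (hA₂ : 0 ≤ A₂) {K j : ℕ} (h : j + (K - 1) / m ≤ K) :
    Real.exp (A₂ * K) ≤ Real.exp (A₂ * m) * (F.scheme ℰp γ).β (K - j) ^ ⌈A₂ * m / Real.log F.L⌉₊ := by
  set A : ℕ := ⌈A₂ * m / Real.log F.L⌉₊ with hA
  have hL1 : (1 : ℝ) < F.L := by exact_mod_cast F.hL.2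
  have hL0 : (0 : ℝ) < F.L := lt_trans zero_lt_one hL1
  have hlog : 0 < Real.log F.L := Real.log_pos hL1
  have hK : (K : ℝ) ≤ (m : ℝ) * ((K - j : ℕ) : ℝ) + m := cast_le_mul_height_add hm h
  have hAm : A₂ * m ≤ (A : ℝ) * Real.log F.L := by
    have h' : A₂ * m / Real.log F.L ≤ A := Nat.le_ceil _
    rwa [div_le_iff₀ hlog] at h'
  have hβ : Real.exp (A₂ * m * ((K - j : ℕ) : ℝ)) ≤ (F.scheme ℰp γ).β (K - j) ^ A := by
    calc Real.exp (A₂ * m * ((K - j : ℕ) : ℝ))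
        ≤ Real.exp ((A : ℝ) * Real.log F.L * ((K - j : ℕ) : ℝ)) :=
          Real.exp_le_exp.mpr (mul_le_mul_of_nonneg_right hAm (Nat.cast_nonneg _))
      _ = Real.exp (Real.log F.L) ^ ((K - j) * A) := by
          rw [← Real.exp_nat_mul]; congr 1; push_cast; ring
      _ = ((F.L : ℝ) ^ (K - j)) ^ A := by rw [Real.exp_log hL0, pow_mul]
      _ ≤ (F.scheme ℰp γ).β (K - j) ^ A := pow_le_pow_left₀ (pow_nonneg hL0.le _) (pow_le_scheme_β F hγ hγ1 (K - j)) A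
  have hlin : A₂ * K ≤ A₂ * m + A₂ * m * ((K - j : ℕ) : ℝ) := by
    have h' := mul_le_mul_of_nonneg_left hK hA₂
    linarith [h', (by ring : A₂ * ((m : ℝ) * ((K - j : ℕ) : ℝ) + m) = A₂ * m + A₂ * m * ((K - j : ℕ) : ℝ))]
  calc Real.exp (A₂ * K) ≤ Real.exp (A₂ * m + A₂ * m * ((K - j : ℕ) : ℝ)) := Real.exp_le_exp.mpr hlin
    _ = Real.exp (A₂ * m) * Real.exp (A₂ * m * ((K - j : ℕ) : ℝ)) := Real.exp_add _ _
    _ ≤ Real.exp (A₂ * m) * (F.scheme ℰp γ).β (K - j) ^ A := mul_le_mul_of_nonneg_left hβ (Real.exp_pos _).le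

/-! ## §1 The `p(g)`-slot: `x(g_{K−j}) ≥ 1 + (K−j)·log L∕2`, `p(g)² ≥ b₀²(log L∕2)⁴(K−j)⁴`, `e^{A₂K²}·e^{−c p²} ≤ e^{C}·e^{−(c∕2)p²}` -/

/-- **THE LOGARITHMIC UNIT GROWS LINEARLY DOWN THE HEIGHTS**: `x(√(γ·L^{−i})) = 1 + (i·log L + log γ⁻¹)∕2 ≥ 1 + i·log L∕2` for `0 < γ ≤ 1`
(`x(g) = 1 + log g⁻¹`, ✓`B10LargeField.xlog`). [cite: Balaban1985UV3, (5) p.256 + (7) p.257] -/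
theorem one_add_mul_le_xlog_sqrt (F : T3Family) {γ : ℝ} (hγ : 0 < γ) (hγ1 : γ ≤ 1) (i : ℕ) :
    1 + (i : ℝ) * (Real.log F.L / 2) ≤ xlog (Real.sqrt (γ * ((F.L : ℝ)⁻¹) ^ i)) := by
  have hL0 : (0 : ℝ) < F.L := by exact_mod_cast lt_trans zero_lt_one F.hL.2
  have hLi : (0 : ℝ) < ((F.L : ℝ)⁻¹) ^ i := pow_pos (inv_pos.mpr hL0) i
  have hpos : 0 < γ * ((F.L : ℝ)⁻¹) ^ i := mul_pos hγ hLi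
  have hlogγ : Real.log γ ≤ 0 := Real.log_nonpos hγ.le hγ1
  show 1 + (i : ℝ) * (Real.log F.L / 2) ≤ 1 + Real.log (Real.sqrt (γ * ((F.L : ℝ)⁻¹) ^ i))⁻¹
  rw [Real.log_inv, Real.log_sqrt hpos.le, Real.log_mul hγ.ne' hLi.ne', Real.log_pow, Real.log_inv]
  linarith

/-- **THE RATE DOMINATES EVERY QUARTIC IN THE HEIGHT**: for `0 < γ ≤ 1`, `2 ≤ p₀`: `b₀²·(log L∕2)⁴·i⁴ ≤ p_{b₀,p₀}(√(γ·L^{−i}))²`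
(`p² = b₀²x^{2p₀} ≥ b₀²x⁴`, `x ≥ i·log L∕2 ≥ 0`). [cite: Balaban1985UV3, (7) p.257] -/
theorem mul_pow_four_le_pFun_sq (F : T3Family) {γ : ℝ} (hγ : 0 < γ) (hγ1 : γ ≤ 1) (b₀ : ℝ) {p₀ : ℝ} (hp : 2 ≤ p₀) (i : ℕ) :
    b₀ ^ 2 * (Real.log F.L / 2) ^ 4 * (i : ℝ) ^ 4 ≤ B10.pFun b₀ p₀ (Real.sqrt (γ * ((F.L : ℝ)⁻¹) ^ i)) ^ 2 := by
  set g : ℝ := Real.sqrt (γ * ((F.L : ℝ)⁻¹) ^ i) with hg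
  have hL1 : (1 : ℝ) < F.L := by exact_mod_cast F.hL.2
  have hL0 : (0 : ℝ) < F.L := lt_trans zero_lt_one hL1
  have hlog : 0 ≤ Real.log F.L / 2 := by have := Real.log_pos hL1; positivity
  have hLi : ((F.L : ℝ)⁻¹) ^ i ≤ 1 := pow_le_one₀ (inv_nonneg.mpr hL0.le) (inv_le_one_of_one_le₀ hL1.le)
  have hpos : 0 < γ * ((F.L : ℝ)⁻¹) ^ i := mul_pos hγ (pow_pos (inv_pos.mpr hL0) i)
  have hg0 : 0 < g := Real.sqrt_pos.mpr hpos
  have hg1 : g ≤ 1 := by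
    rw [hg, Real.sqrt_le_one]
    calc γ * ((F.L : ℝ)⁻¹) ^ i ≤ 1 * 1 := mul_le_mul hγ1 hLi (pow_nonneg (inv_nonneg.mpr hL0.le) i) zero_le_one
      _ = 1 := one_mul 1
  have hx1 : 1 ≤ xlog g := one_le_xlog hg0 hg1
  have hx0 : 0 ≤ xlog g := zero_le_one.trans hx1
  have hxi : (i : ℝ) * (Real.log F.L / 2) ≤ xlog g := by
    have := one_add_mul_le_xlog_sqrt F hγ hγ1 i
    rw [← hg] at this; linarith
  have hi0 : 0 ≤ (i : ℝ) * (Real.log F.L / 2) := mul_nonneg (Nat.cast_nonneg _) hlog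
  -- `x^{2p₀} ≥ x^4 ≥ (i·log L/2)^4`
  have h4 : xlog g ^ (4 : ℕ) ≤ xlog g ^ (2 * p₀) := by
    have e : xlog g ^ ((4 : ℕ) : ℝ) = xlog g ^ (4 : ℕ) := Real.rpow_natCast (xlog g) 4
    rw [← e]
    exact Real.rpow_le_rpow_of_exponent_le hx1 (by push_cast; linarith)
  have h44 : ((i : ℝ) * (Real.log F.L / 2)) ^ 4 ≤ xlog g ^ (4 : ℕ) := pow_le_pow_left₀ hi0 hxi 4
  have hsq := (UV3PinnedStepOrganOfMassEnvelope.pFun_sq_eq (c₁ := 0) (b₀ := b₀) (p₀ := p₀) hg0 hg1).1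
  rw [hsq]
  have h' : ((i : ℝ) * (Real.log F.L / 2)) ^ 4 ≤ xlog g ^ (2 * p₀) := h44.trans h4
  calc b₀ ^ 2 * (Real.log F.L / 2) ^ 4 * (i : ℝ) ^ 4 = b₀ ^ 2 * ((i : ℝ) * (Real.log F.L / 2)) ^ 4 := by ring
    _ ≤ b₀ ^ 2 * xlog g ^ (2 * p₀) := mul_le_mul_of_nonneg_left h' (sq_nonneg b₀)

/-- **THE `p(g)`-SLOT ABSORBS A `K`-QUADRATIC LOG-ENVELOPE**: for `A₂ ≥ 0`, `m > 0`, `0 < γ ≤ 1`, `0 < b₀`, `2 ≤ p₀`, `0 < c₀` and a constrained height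
`j + 2 ≤ K`, `j + ⌊(K−1)∕m⌋ ≤ K`: `e^{A₂K²}·e^{−c₀·p(g_{K−j})²} ≤ e^{(4A₂m²)²∕(4κ)}·e^{−(c₀∕2)·p(g_{K−j})²}`, `κ = (c₀∕2)·b₀²·(log L∕2)⁴`
(`K ≤ 2m(K−j)`, `p² ≥ b₀²(log L∕2)⁴(K−j)⁴`, and `a·t² ≤ κ·t⁴ + a²∕(4κ)`). [cite: Balaban1985UV3, (5) p.256 + (7) p.257] -/
theorem exp_mul_sq_mul_exp_neg_le (F : T3Family) {γ : ℝ} (hγ : 0 < γ) (hγ1 : γ ≤ 1) {b₀ p₀ : ℝ} (hb : 0 < b₀) (hp : 2 ≤ p₀)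
    {c₀ : ℝ} (hc : 0 < c₀) {m : ℕ} (hm : 0 < m) {A₂ : ℝ} (hA₂ : 0 ≤ A₂) {K j : ℕ} (hjK : j + 2 ≤ K) (h : j + (K - 1) / m ≤ K) :
    Real.exp (A₂ * (K : ℝ) ^ 2) * Real.exp (-(c₀ * B10.pFun b₀ p₀ (Real.sqrt (γ * ((F.L : ℝ)⁻¹) ^ (K - j))) ^ 2)) ≤
      Real.exp ((4 * A₂ * (m : ℝ) ^ 2) ^ 2 / (4 * (c₀ / 2 * (b₀ ^ 2 * (Real.log F.L / 2) ^ 4)))) *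
        Real.exp (-(c₀ / 2 * B10.pFun b₀ p₀ (Real.sqrt (γ * ((F.L : ℝ)⁻¹) ^ (K - j))) ^ 2)) := by
  set t : ℝ := ((K - j : ℕ) : ℝ) with ht
  set P : ℝ := B10.pFun b₀ p₀ (Real.sqrt (γ * ((F.L : ℝ)⁻¹) ^ (K - j))) ^ 2 with hP
  set κ : ℝ := c₀ / 2 * (b₀ ^ 2 * (Real.log F.L / 2) ^ 4) with hκ
  set a : ℝ := 4 * A₂ * (m : ℝ) ^ 2 with ha
  have hL1 : (1 : ℝ) < F.L := by exact_mod_cast F.hL.2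
  have hlog : 0 < Real.log F.L / 2 := by have := Real.log_pos hL1; positivity
  have hκ0 : 0 < κ := by rw [hκ]; positivity
  have ht1 : 1 ≤ t := by rw [ht]; exact_mod_cast (show 1 ≤ K - j by omega)
  have hmr : (0 : ℝ) < m := by exact_mod_cast hm
  have hK : (K : ℝ) ≤ (m : ℝ) * t + m := cast_le_mul_height_add hm h
  have hK2 : (K : ℝ) ≤ 2 * m * t := by nlinarith
  have hKsq : (K : ℝ) ^ 2 ≤ 4 * (m : ℝ) ^ 2 * t ^ 2 := by
    have hK0 : (0 : ℝ) ≤ K := Nat.cast_nonneg K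
    nlinarith
  have hPt : b₀ ^ 2 * (Real.log F.L / 2) ^ 4 * t ^ 4 ≤ P := mul_pow_four_le_pFun_sq F hγ hγ1 b₀ hp (K - j)
  -- AM–GM: `a t² ≤ κ t⁴ + a²/(4κ)`
  have hamgm : a * t ^ 2 ≤ κ * t ^ 4 + a ^ 2 / (4 * κ) := by
    have hsq : 0 ≤ κ * (t ^ 2 - a / (2 * κ)) ^ 2 := mul_nonneg hκ0.le (sq_nonneg _)
    have e : κ * (t ^ 2 - a / (2 * κ)) ^ 2 = κ * t ^ 4 - a * t ^ 2 + a ^ 2 / (4 * κ) := by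
      field_simp
      ring
    linarith [hsq, e]
  have hmain : A₂ * (K : ℝ) ^ 2 ≤ c₀ / 2 * P + a ^ 2 / (4 * κ) := by
    have h1 : A₂ * (K : ℝ) ^ 2 ≤ a * t ^ 2 := by
      rw [ha]; nlinarith [mul_le_mul_of_nonneg_left hKsq hA₂]
    have h2 : κ * t ^ 4 ≤ c₀ / 2 * P := by
      rw [hκ]
      have := mul_le_mul_of_nonneg_left hPt (show (0 : ℝ) ≤ c₀ / 2 by positivity)
      linarith [this, (by ring : c₀ / 2 * (b₀ ^ 2 * (Real.log F.L / 2) ^ 4 * t ^ 4) = c₀ / 2 * (b₀ ^ 2 * (Real.log F.L / 2) ^ 4) * t ^ 4)]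
    linarith
  rw [← Real.exp_add, ← Real.exp_add]
  apply Real.exp_le_exp.mpr
  linarith

/-! ## §2 The (S-ii) row of record from the K-LINEAR envelope hJ♭ -/

variable {F : T3Family} {𝔠 : AlphaConsts F.L (suGroupModel 2).N}

open Classical in
/-- ★★★ **THE ORGAN ROW (S-ii) `hSii` OF R-19936-S (✓`UV3PinnedStepKnitOfPackage.pinnedTop_of_pinnedLF`'s binder, VERBATIM) FROM THE `K`-LINEARLY GROWING TOP-LEVEL
A.E. MASS ENVELOPE hJ♭.**  Per family `F`, record `𝔠`, socket `h : Of F 𝔠`, coupling `γ` in the window and depth `m > 0`: IF there are `A₁, A₂` such that for every run `K`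
and every ADMISSIBLE NON-TRIVIAL history `r` the lane's mass satisfies `m_K(r, ·) ≤ exp(A₁ + A₂·K)` `dV_K`-a.e., THEN `hSii` holds with
`CZ := A₁ + A₂⁺·m + (6∕log L)(2L^m)³ + log(1 + C_coll∕ℓ)`, `c := 1∕(64N) = 1∕128`, `A := ⌈A₂⁺·m∕log L⌉₊` (`A₂⁺ = max A₂ 0`): w6 g7's per-run
✓`pinnedLF_le_of_massEnvelope` at the envelope `A₁ + A₂⁺·K`, then §0 `exp_mul_le_exp_mul_beta_pow` on the constrained heights.  The `K`-UNIFORM row hJ of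
✓`AlphaInputsT3AC.Of.hSii_of_massEnvelope` is the case `A₂ = 0` (§4). [cite: Balaban1985UV3, (41) p.266, (67)–(71) p.273, pp.273–274, (5) p.256, (7) p.257] -/
theorem _root_.Summit.QuantumFields.YangMills.Theorems.AlphaInputsT3AC.Of.hSii_of_growingMassEnvelope (h : AlphaInputsT3AC.Of F 𝔠)
    (γ : ℝ) (hγ : 0 < γ) (hγ1 : γ ≤ (min 𝔠.gamma0 1) ^ 2) {m : ℕ} (hm : 0 < m)
    (hJ : ∃ A₁ A₂ : ℝ, ∀ (K : ℕ) (r : Hist (F.P K) K),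
      Hist.Admissible 𝔠.lane.carrier.M₁ (rcolOf (T3Scales F γ hγ (hγ1.trans (sq_min_one_le _ 𝔠.gamma0_pos)) K) 𝔠.lane.carrier) K r →
      r ≠ Hist.triv (F.P K) K →
      ∀ᵐ W ∂(fieldMeasure (F.P K) K (Matrix.specialUnitaryGroup (Fin 2) ℂ)),
        (inputOfAC 𝔠.lane (h.pkgAt γ hγ hγ1 K).X (h.pkgAt γ hγ hγ1 K).𝔖).W.mass K r W ≤ Real.exp (A₁ + A₂ * K)) :
    ∃ (CZ c : ℝ) (A : ℕ), 0 < c ∧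
      ∀ (K j : ℕ) (hj1 : 1 ≤ j) (hjK : j + 2 ≤ K), j + (K - 1) / m ≤ K → ∀ (a : Plaq (F.P K) j),
        ∀ᵐ W ∂(fieldMeasure (F.P K) K (Matrix.specialUnitaryGroup (Fin 2) ℂ)),
        ∑ r ∈ Finset.univ.filter (fun r : Hist (F.P K) K =>
            a ∈ r ⟨j, by omega⟩ ∨ ¬ plaqCover a ⊆ Omega 𝔠.lane.carrier.M₁
              (rcolOf (T3Scales F γ hγ (hγ1.trans (sq_min_one_le _ 𝔠.gamma0_pos)) K) 𝔠.lane.carrier) j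
              (fun i : Fin j => r (Fin.castLE (by omega) i)) j),
          (inputOfAC 𝔠.lane (h.pkgAt γ hγ hγ1 K).X (h.pkgAt γ hγ hγ1 K).𝔖).W.mass K r W *
            Real.exp (-((h.pkgAt γ hγ hγ1 K).T.mainT K r W) + (h.pkgAt γ hγ hγ1 K).T.Zterm K r) ≤
        Real.exp CZ * ((F.scheme ℰp γ).β (K - j) ^ A *
          Real.exp (-(c * B10.pFun 𝔠.b₀ 𝔠.p₀ (Real.sqrt (γ * ((F.L : ℝ)⁻¹) ^ (K - j))) ^ 2))) := by
  obtain ⟨A₁, A₂, hA⟩ := hJ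
  set B : ℝ := max A₂ 0 with hB
  have hB0 : 0 ≤ B := le_max_right _ _
  have hAB : A₂ ≤ B := le_max_left _ _
  have hγone : γ ≤ 1 := hγ1.trans ((sq_le_one_iff₀ (le_min 𝔠.gamma0_pos.le zero_le_one)).mpr (min_le_right _ _))
  have hNpos : (0 : ℝ) < ((suGroupModel 2).N : ℝ) := by exact_mod_cast (suGroupModel 2).N_pos
  set X : ℝ := 3 / (Real.log F.L / 2) * (2 * (F.L : ℝ) ^ F.m) ^ 3 +
      Real.log (1 + 9 * (2 * (2 * ((𝔠.lane.carrier.R₁ + 1) * 𝔠.lane.carrier.M₁) +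
        2 * ((F.L : ℝ) * (3 * ((𝔠.lane.carrier.M₁ : ℝ) - 1)) + 3 * ((F.L : ℝ) - 1)) + 15 * F.L + 7) + 6) ^ 3 / (Real.log F.L / 2)) with hX
  refine ⟨A₁ + B * m + X, 1 / (4 * ((suGroupModel 2).N : ℝ)) / 16, ⌈B * m / Real.log F.L⌉₊, by positivity,
    fun K j hj1 hjK hjm a => ?_⟩
  -- the envelope of run `K` (monotone in `A₂ ↦ B`), gathered over the finitely many histories
  have hae : ∀ᵐ W ∂(fieldMeasure (F.P K) K (Matrix.specialUnitaryGroup (Fin 2) ℂ)), ∀ r : Hist (F.P K) K,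
      Hist.Admissible 𝔠.lane.carrier.M₁ (rcolOf (T3Scales F γ hγ (hγ1.trans (sq_min_one_le _ 𝔠.gamma0_pos)) K) 𝔠.lane.carrier) K r →
      r ≠ Hist.triv (F.P K) K → (inputOfAC 𝔠.lane (h.pkgAt γ hγ hγ1 K).X (h.pkgAt γ hγ hγ1 K).𝔖).W.mass K r W ≤
        Real.exp (A₁ + B * K) := by
    refine ae_all_iff.2 fun r => ?_
    by_cases hadm : Hist.Admissible 𝔠.lane.carrier.M₁
      (rcolOf (T3Scales F γ hγ (hγ1.trans (sq_min_one_le _ 𝔠.gamma0_pos)) K) 𝔠.lane.carrier) K r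
    · by_cases hne : r = Hist.triv (F.P K) K
      · exact Filter.Eventually.of_forall fun W _ h2 => absurd hne h2
      · filter_upwards [hA K r hadm hne] with W hW
        intro _ _
        refine hW.trans (Real.exp_le_exp.mpr ?_)
        have := mul_le_mul_of_nonneg_right hAB (Nat.cast_nonneg K)
        linarith
    · exact Filter.Eventually.of_forall fun W h1 _ => absurd h1 hadm
  filter_upwards [hae] with W hW
  have h1 := pinnedLF_le_of_massEnvelope (h.pkgAt γ hγ hγ1 K) (by omega) a W hW
  refine h1.trans ?_
  have hβ := exp_mul_le_exp_mul_beta_pow F hγ hγone hm hB0 (K := K) (j := j) hjm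
  have e1 : A₁ + B * K + 3 / (Real.log F.L / 2) * (2 * (F.L : ℝ) ^ F.m) ^ 3 +
      Real.log (1 + 9 * (2 * (2 * ((𝔠.lane.carrier.R₁ + 1) * 𝔠.lane.carrier.M₁) +
        2 * ((F.L : ℝ) * (3 * ((𝔠.lane.carrier.M₁ : ℝ) - 1)) + 3 * ((F.L : ℝ) - 1)) + 15 * F.L + 7) + 6) ^ 3 / (Real.log F.L / 2)) =
      (A₁ + X) + B * K := by rw [hX]; ring
  rw [e1, show A₁ + B * m + X = (A₁ + X) + B * m by ring]
  set E : ℝ := Real.exp (-(1 / (4 * ((suGroupModel 2).N : ℝ)) / 16 *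
    B10.pFun 𝔠.b₀ 𝔠.p₀ (Real.sqrt (γ * ((F.L : ℝ)⁻¹) ^ (K - j))) ^ 2)) with hE
  have hE0 : 0 ≤ E := (Real.exp_pos _).le
  calc Real.exp ((A₁ + X) + B * K) * E = Real.exp (A₁ + X) * Real.exp (B * K) * E := by rw [Real.exp_add (A₁ + X)]
    _ ≤ Real.exp (A₁ + X) * (Real.exp (B * m) * (F.scheme ℰp γ).β (K - j) ^ ⌈B * m / Real.log F.L⌉₊) * E :=
        mul_le_mul_of_nonneg_right (mul_le_mul_of_nonneg_left hβ (Real.exp_pos _).le) hE0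
    _ = Real.exp ((A₁ + X) + B * m) * ((F.scheme ℰp γ).β (K - j) ^ ⌈B * m / Real.log F.L⌉₊ * E) := by
        rw [Real.exp_add (A₁ + X)]; ring

/-! ## §3 The (S-ii) row of record from the K-QUADRATIC envelope hJ♯ -/

open Classical in
/-- ★★★ **THE ORGAN ROW (S-ii) `hSii` OF R-19936-S FROM THE `K`-QUADRATICALLY GROWING TOP-LEVEL A.E. MASS ENVELOPE hJ♯.**  Per family `F`, record `𝔠`, socket
`h : Of F 𝔠`, coupling `γ` in the window and depth `m > 0`: IF there are `A₁, A₂` such that for every run `K` and every ADMISSIBLE NON-TRIVIAL history `r` the lane's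
mass satisfies `m_K(r, ·) ≤ exp(A₁ + A₂·K²)` `dV_K`-a.e., THEN `hSii` holds with `c := 1∕(128N) = 1∕256`, `A := 0`,
`CZ := A₁ + (6∕log L)(2L^m)³ + log(1 + C_coll∕ℓ) + (4A₂⁺m²)²∕(4κ)`, `κ = (1∕256)·𝔠.b₀²·(log L∕2)⁴`: w6 g7's per-run ✓`pinnedLF_le_of_massEnvelope` at the
envelope `A₁ + A₂⁺·K²`, then §1 `exp_mul_sq_mul_exp_neg_le` (`𝔠.b₀_pos`, `𝔠.two_lt_p₀`).  Any `e^{o(p_𝔠(g_{K−j})²)}` envelope is absorbed the same way.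
[cite: Balaban1985UV3, (41) p.266, (67)–(71) p.273, pp.273–274, (5) p.256, (7) p.257] -/
theorem _root_.Summit.QuantumFields.YangMills.Theorems.AlphaInputsT3AC.Of.hSii_of_quadGrowingMassEnvelope (h : AlphaInputsT3AC.Of F 𝔠)
    (γ : ℝ) (hγ : 0 < γ) (hγ1 : γ ≤ (min 𝔠.gamma0 1) ^ 2) {m : ℕ} (hm : 0 < m)
    (hJ : ∃ A₁ A₂ : ℝ, ∀ (K : ℕ) (r : Hist (F.P K) K),
      Hist.Admissible 𝔠.lane.carrier.M₁ (rcolOf (T3Scales F γ hγ (hγ1.trans (sq_min_one_le _ 𝔠.gamma0_pos)) K) 𝔠.lane.carrier) K r →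
      r ≠ Hist.triv (F.P K) K →
      ∀ᵐ W ∂(fieldMeasure (F.P K) K (Matrix.specialUnitaryGroup (Fin 2) ℂ)),
        (inputOfAC 𝔠.lane (h.pkgAt γ hγ hγ1 K).X (h.pkgAt γ hγ hγ1 K).𝔖).W.mass K r W ≤ Real.exp (A₁ + A₂ * (K : ℝ) ^ 2)) :
    ∃ (CZ c : ℝ) (A : ℕ), 0 < c ∧
      ∀ (K j : ℕ) (hj1 : 1 ≤ j) (hjK : j + 2 ≤ K), j + (K - 1) / m ≤ K → ∀ (a : Plaq (F.P K) j),
        ∀ᵐ W ∂(fieldMeasure (F.P K) K (Matrix.specialUnitaryGroup (Fin 2) ℂ)),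
        ∑ r ∈ Finset.univ.filter (fun r : Hist (F.P K) K =>
            a ∈ r ⟨j, by omega⟩ ∨ ¬ plaqCover a ⊆ Omega 𝔠.lane.carrier.M₁
              (rcolOf (T3Scales F γ hγ (hγ1.trans (sq_min_one_le _ 𝔠.gamma0_pos)) K) 𝔠.lane.carrier) j
              (fun i : Fin j => r (Fin.castLE (by omega) i)) j),
          (inputOfAC 𝔠.lane (h.pkgAt γ hγ hγ1 K).X (h.pkgAt γ hγ hγ1 K).𝔖).W.mass K r W *
            Real.exp (-((h.pkgAt γ hγ hγ1 K).T.mainT K r W) + (h.pkgAt γ hγ hγ1 K).T.Zterm K r) ≤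
        Real.exp CZ * ((F.scheme ℰp γ).β (K - j) ^ A *
          Real.exp (-(c * B10.pFun 𝔠.b₀ 𝔠.p₀ (Real.sqrt (γ * ((F.L : ℝ)⁻¹) ^ (K - j))) ^ 2))) := by
  obtain ⟨A₁, A₂, hA⟩ := hJ
  set B : ℝ := max A₂ 0 with hB
  have hB0 : 0 ≤ B := le_max_right _ _
  have hAB : A₂ ≤ B := le_max_left _ _
  have hγone : γ ≤ 1 := hγ1.trans ((sq_le_one_iff₀ (le_min 𝔠.gamma0_pos.le zero_le_one)).mpr (min_le_right _ _))
  have hNpos : (0 : ℝ) < ((suGroupModel 2).N : ℝ) := by exact_mod_cast (suGroupModel 2).N_pos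
  have hc0 : (0 : ℝ) < 1 / (4 * ((suGroupModel 2).N : ℝ)) / 16 := by positivity
  set X : ℝ := 3 / (Real.log F.L / 2) * (2 * (F.L : ℝ) ^ F.m) ^ 3 +
      Real.log (1 + 9 * (2 * (2 * ((𝔠.lane.carrier.R₁ + 1) * 𝔠.lane.carrier.M₁) +
        2 * ((F.L : ℝ) * (3 * ((𝔠.lane.carrier.M₁ : ℝ) - 1)) + 3 * ((F.L : ℝ) - 1)) + 15 * F.L + 7) + 6) ^ 3 / (Real.log F.L / 2)) with hX
  set Cq : ℝ := (4 * B * (m : ℝ) ^ 2) ^ 2 / (4 * (1 / (4 * ((suGroupModel 2).N : ℝ)) / 16 / 2 * (𝔠.b₀ ^ 2 * (Real.log F.L / 2) ^ 4))) with hCq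
  refine ⟨A₁ + X + Cq, 1 / (4 * ((suGroupModel 2).N : ℝ)) / 16 / 2, 0, by positivity, fun K j hj1 hjK hjm a => ?_⟩
  have hae : ∀ᵐ W ∂(fieldMeasure (F.P K) K (Matrix.specialUnitaryGroup (Fin 2) ℂ)), ∀ r : Hist (F.P K) K,
      Hist.Admissible 𝔠.lane.carrier.M₁ (rcolOf (T3Scales F γ hγ (hγ1.trans (sq_min_one_le _ 𝔠.gamma0_pos)) K) 𝔠.lane.carrier) K r →
      r ≠ Hist.triv (F.P K) K → (inputOfAC 𝔠.lane (h.pkgAt γ hγ hγ1 K).X (h.pkgAt γ hγ hγ1 K).𝔖).W.mass K r W ≤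
        Real.exp (A₁ + B * (K : ℝ) ^ 2) := by
    refine ae_all_iff.2 fun r => ?_
    by_cases hadm : Hist.Admissible 𝔠.lane.carrier.M₁
      (rcolOf (T3Scales F γ hγ (hγ1.trans (sq_min_one_le _ 𝔠.gamma0_pos)) K) 𝔠.lane.carrier) K r
    · by_cases hne : r = Hist.triv (F.P K) K
      · exact Filter.Eventually.of_forall fun W _ h2 => absurd hne h2
      · filter_upwards [hA K r hadm hne] with W hW
        intro _ _
        refine hW.trans (Real.exp_le_exp.mpr ?_)
        have := mul_le_mul_of_nonneg_right hAB (sq_nonneg (K : ℝ))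
        linarith
    · exact Filter.Eventually.of_forall fun W h1 _ => absurd h1 hadm
  filter_upwards [hae] with W hW
  have h1 := pinnedLF_le_of_massEnvelope (h.pkgAt γ hγ hγ1 K) (by omega) a W hW
  refine h1.trans ?_
  have hq := exp_mul_sq_mul_exp_neg_le F hγ hγone 𝔠.b₀_pos 𝔠.two_lt_p₀.le hc0 hm hB0 hjK hjm
  rw [← hCq] at hq
  have e1 : A₁ + B * (K : ℝ) ^ 2 + 3 / (Real.log F.L / 2) * (2 * (F.L : ℝ) ^ F.m) ^ 3 +
      Real.log (1 + 9 * (2 * (2 * ((𝔠.lane.carrier.R₁ + 1) * 𝔠.lane.carrier.M₁) +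
        2 * ((F.L : ℝ) * (3 * ((𝔠.lane.carrier.M₁ : ℝ) - 1)) + 3 * ((F.L : ℝ) - 1)) + 15 * F.L + 7) + 6) ^ 3 / (Real.log F.L / 2)) =
      (A₁ + X) + B * (K : ℝ) ^ 2 := by rw [hX]; ring
  rw [e1, pow_zero, one_mul, Real.exp_add (A₁ + X), Real.exp_add (A₁ + X), mul_assoc, mul_assoc]
  exact mul_le_mul_of_nonneg_left hq (Real.exp_pos _).le

/-! ## §4 Monotonicity records: hJ ⟹ hJ♭ ⟹ hJ♯ (the relaxed rows are WEAKER displays) -/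

/-- `e^{A₁ + A₂·K} ≤ e^{A₁ + A₂⁺·K²}`: the `K`-linear envelope is below the `K`-quadratic one (`K ≤ K²` on `ℕ`, `A₂⁺ = max A₂ 0`). [folklore] -/
theorem exp_add_mul_le_exp_add_mul_sq (A₁ A₂ : ℝ) (K : ℕ) :
    Real.exp (A₁ + A₂ * (K : ℝ)) ≤ Real.exp (A₁ + max A₂ 0 * (K : ℝ) ^ 2) := by
  apply Real.exp_le_exp.mpr
  have hK : (K : ℝ) ≤ (K : ℝ) ^ 2 := by
    rcases Nat.eq_zero_or_pos K with hK0 | hK1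
    · simp [hK0]
    · have : (1 : ℝ) ≤ K := by exact_mod_cast hK1
      nlinarith
  have h1 : A₂ * (K : ℝ) ≤ max A₂ 0 * (K : ℝ) := mul_le_mul_of_nonneg_right (le_max_left _ _) (Nat.cast_nonneg K)
  have h2 : max A₂ 0 * (K : ℝ) ≤ max A₂ 0 * (K : ℝ) ^ 2 := mul_le_mul_of_nonneg_left hK (le_max_right _ _)
  linarith

/-- **hJ ⟹ hJ♭**: the `K`-uniform displayed row of ✓`AlphaInputsT3AC.Of.hSii_of_massEnvelope` implies the `K`-linear row of §2 (`A₂ := 0`). [folklore] -/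
theorem _root_.Summit.QuantumFields.YangMills.Theorems.AlphaInputsT3AC.Of.growingMassEnvelope_of_massEnvelope (h : AlphaInputsT3AC.Of F 𝔠)
    (γ : ℝ) (hγ : 0 < γ) (hγ1 : γ ≤ (min 𝔠.gamma0 1) ^ 2)
    (hJ : ∃ A₁ : ℝ, ∀ (K : ℕ) (r : Hist (F.P K) K),
      Hist.Admissible 𝔠.lane.carrier.M₁ (rcolOf (T3Scales F γ hγ (hγ1.trans (sq_min_one_le _ 𝔠.gamma0_pos)) K) 𝔠.lane.carrier) K r →
      r ≠ Hist.triv (F.P K) K →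
      ∀ᵐ W ∂(fieldMeasure (F.P K) K (Matrix.specialUnitaryGroup (Fin 2) ℂ)),
        (inputOfAC 𝔠.lane (h.pkgAt γ hγ hγ1 K).X (h.pkgAt γ hγ hγ1 K).𝔖).W.mass K r W ≤ Real.exp A₁) :
    ∃ A₁ A₂ : ℝ, ∀ (K : ℕ) (r : Hist (F.P K) K),
      Hist.Admissible 𝔠.lane.carrier.M₁ (rcolOf (T3Scales F γ hγ (hγ1.trans (sq_min_one_le _ 𝔠.gamma0_pos)) K) 𝔠.lane.carrier) K r →
      r ≠ Hist.triv (F.P K) K →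
      ∀ᵐ W ∂(fieldMeasure (F.P K) K (Matrix.specialUnitaryGroup (Fin 2) ℂ)),
        (inputOfAC 𝔠.lane (h.pkgAt γ hγ hγ1 K).X (h.pkgAt γ hγ hγ1 K).𝔖).W.mass K r W ≤ Real.exp (A₁ + A₂ * K) := by
  obtain ⟨A₁, hA⟩ := hJ
  refine ⟨A₁, 0, fun K r hadm hne => ?_⟩
  filter_upwards [hA K r hadm hne] with W hW
  rwa [zero_mul, add_zero]

/-- **hJ♭ ⟹ hJ♯**: the `K`-linear row of §2 implies the `K`-quadratic row of §3 (`A₂ ↦ A₂⁺`). [folklore] -/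
theorem _root_.Summit.QuantumFields.YangMills.Theorems.AlphaInputsT3AC.Of.quadGrowingMassEnvelope_of_growingMassEnvelope
    (h : AlphaInputsT3AC.Of F 𝔠) (γ : ℝ) (hγ : 0 < γ) (hγ1 : γ ≤ (min 𝔠.gamma0 1) ^ 2)
    (hJ : ∃ A₁ A₂ : ℝ, ∀ (K : ℕ) (r : Hist (F.P K) K),
      Hist.Admissible 𝔠.lane.carrier.M₁ (rcolOf (T3Scales F γ hγ (hγ1.trans (sq_min_one_le _ 𝔠.gamma0_pos)) K) 𝔠.lane.carrier) K r →
      r ≠ Hist.triv (F.P K) K →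
      ∀ᵐ W ∂(fieldMeasure (F.P K) K (Matrix.specialUnitaryGroup (Fin 2) ℂ)),
        (inputOfAC 𝔠.lane (h.pkgAt γ hγ hγ1 K).X (h.pkgAt γ hγ hγ1 K).𝔖).W.mass K r W ≤ Real.exp (A₁ + A₂ * K)) :
    ∃ A₁ A₂ : ℝ, ∀ (K : ℕ) (r : Hist (F.P K) K),
      Hist.Admissible 𝔠.lane.carrier.M₁ (rcolOf (T3Scales F γ hγ (hγ1.trans (sq_min_one_le _ 𝔠.gamma0_pos)) K) 𝔠.lane.carrier) K r →
      r ≠ Hist.triv (F.P K) K →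
      ∀ᵐ W ∂(fieldMeasure (F.P K) K (Matrix.specialUnitaryGroup (Fin 2) ℂ)),
        (inputOfAC 𝔠.lane (h.pkgAt γ hγ hγ1 K).X (h.pkgAt γ hγ hγ1 K).𝔖).W.mass K r W ≤ Real.exp (A₁ + A₂ * (K : ℝ) ^ 2) := by
  obtain ⟨A₁, A₂, hA⟩ := hJ
  refine ⟨A₁, max A₂ 0, fun K r hadm hne => ?_⟩
  filter_upwards [hA K r hadm hne] with W hW
  exact hW.trans (exp_add_mul_le_exp_add_mul_sq A₁ A₂ K)

end Summit.QuantumFields.YangMills.Theorems.UV3PinnedStepOrganOfGrowingMassEnvelope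

end
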